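import Summits.BirchSwinnertonDyer.BirchSwinnertonDyer.Theorems.SignedLowerHalvesKobayashiMainConjectureSmallImageHeckePrimeMu
import Summits.BirchSwinnertonDyer.BirchSwinnertonDyer.Theorems.SignedLowerHalvesKobayashiMainConjectureSmallImageOrbitSumMuThree
import HarnessLib

/-!
# Route `SignedLowerHalves`, crux `KobayashiMainConjectureSmallImage` (item stmt-BirchSwinnertonDyer-19002),
# line `birth_acns`, stub `stub_muOneSign_ns_three`: COROLLARIES of the reduction to LEMMA′ (`…SmallImageHeckePrimeMu.lean`) —
# the unit-residue form, the newform-of-a-curve form, and **THEOREM A at `p = 3`: LEMMA′(N,3) ⇒ `min(μ(L₃⁺), μ(L₃⁻)) = 0`**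
# (cell `bsd-ssimc`, seat `bsd-line-slh-p3` gen 8; THEOREMS ONLY; helper)

`exists_unit_norm_ratPlusSymbol_eq_one_of_lemmaPrime` (`∃ n, ∃ u ∈ (ℤ/p^{n+1})ˣ, ‖[u/p^{n+1}]⁺_f‖_p = 1`, by `ℤ`-periodicity of
`[·]⁺`), `…_of_isNewformOf` (hypotheses read off a globally minimal `W/ℚ` with good reduction at `p`, `a_p = 0`), and
`exists_sign_hasUnitContent_three_of_lemmaPrime`: at `p = 3`, with the landed
`SmallImageOrbitSumMuThree.exists_sign_hasUnitContent_three_of_norm_ratPlusSymbol_eq_one` (p636964), LEMMA′(N,3) gives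
`∃ ε L, IsSignedPAdicLFunction f 3 ε L ∧ HasUnitContent L` — `stub_muOneSign_ns_three` of line v6 modulo LEMMA′(N_E, 3), which
line v7 registers as the group-theoretic stub `stub_lemmaPrime_three`. HONEST SCOPE: LEMMA′ is a hypothesis; no new fact; crux 4
OPEN; BSD is not proved by any of this.

References: [MazurTateTeitelbaum1986Invent] §I.4 (4.2), §I.8; [PollackWeston2011] Thm. 4.1 (1), Rem. 4.2; tree `…SmallImageHeckePrimeMu`,
`…SmallImageOrbitSumMuThree`; `Cruxes/KobayashiMainConjectureSmallImage/EG-REDUCTION-g8.md` (THEOREM A/B, LEMMA′).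
-/

-- D-0017: single-problem summit, the namespace repeats the problem name by design.
set_option linter.dupNamespace false
set_option autoImplicit false

noncomputable section

open scoped Classical MatrixGroups ModularForm

open CongruenceSubgroup Literature.NumberTheory.EllipticCurves Literature.NumberTheory.EllipticCurves.ModularForms
  Literature.NumberTheory.EllipticCurves.Kobayashi2003 Literature.NumberTheory.EllipticCurves.GreenbergVatsal2000

namespace Summit.BirchSwinnertonDyer.BirchSwinnertonDyer.Theorems.SmallImageHeckePrimeMu

variable {N : ℕ} [NeZero N] (f : CuspForm (Gamma0 N) 2) {p : ℕ} [Fact p.Prime]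

/-! ## §6 Corollaries: the unit-residue form, the newform-of-a-curve form, and the signed rider at `p = 3` -/

/-- **Unit-residue form**: under the hypotheses of `exists_norm_ratPlusSymbol_eq_one_of_lemmaPrime`, some plus symbol
`[u/p^{n+1}]⁺_f` with `u` a UNIT of `ℤ/p^{n+1}` (represented in `[0, p^{n+1})`) is a `p`-adic unit (`ℤ`-periodicity of `[·]⁺`).
[cite: MazurTateTeitelbaum1986Invent, §I.4 (4.2)] -/
theorem exists_unit_norm_ratPlusSymbol_eq_one_of_lemmaPrime (hp2 : p ≠ 2) (hf0 : IsNewform0 f) (hQ : coeffField f = ⊥)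
    (hpN : ¬ p ∣ N) (hap : cuspCoeff f p = ((0 : ℤ) : ℂ))
    (hLemma : ∀ ψ : Gamma0 N →* Multiplicative (ZMod p),
      (∀ γ : Gamma0 N, (∃ k : ℕ, ((γ : SL(2, ℤ)) 1 1 : ℤ) = (p : ℤ) ^ k ∨ ((γ : SL(2, ℤ)) 1 1 : ℤ) = -((p : ℤ) ^ k)) →
        ψ γ = 1) →
      ∃ χ : (ZMod N)ˣ →* Multiplicative (ZMod p),
        (∀ u : (ZMod N)ˣ, (u : ZMod N) = (p : ZMod N) → χ u = 1) ∧
        ∀ (γ : Gamma0 N) (u : (ZMod N)ˣ), (u : ZMod N) = (((γ : SL(2, ℤ)) 1 1 : ℤ) : ZMod N) → ψ γ = χ u) :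
    ∃ (n : ℕ) (u : (ZMod (p ^ (n + 1)))ˣ),
      ‖((ratPlusSymbol f (((u : ZMod (p ^ (n + 1))).val : ℚ) / (p : ℚ) ^ (n + 1)) : ℚ) : ℚ_[p])‖ = 1 := by
  have hp : p.Prime := Fact.out
  obtain ⟨k, a, hk, ha, hnorm⟩ := exists_norm_ratPlusSymbol_eq_one_of_lemmaPrime f hp2 hf0 hQ hpN hap hLemma
  obtain ⟨n, rfl⟩ : ∃ n, k = n + 1 := ⟨k - 1, by omega⟩
  haveI : NeZero (p ^ (n + 1)) := ⟨pow_ne_zero _ hp.ne_zero⟩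
  -- `a` is a unit modulo `p^{n+1}`
  have hunit : IsUnit ((a : ℤ) : ZMod (p ^ (n + 1))) := by
    have hapk : IsCoprime a ((p : ℤ) ^ (n + 1)) := ha.pow_right
    obtain ⟨x, y, hxy⟩ := hapk
    refine IsUnit.of_mul_eq_one ((x : ℤ) : ZMod (p ^ (n + 1))) ?_
    have hp0 : ((p : ℕ) : ZMod (p ^ (n + 1))) ^ (n + 1) = 0 := by
      rw [← Nat.cast_pow, ZMod.natCast_self]
    have h := congr_arg (fun z : ℤ ↦ (z : ZMod (p ^ (n + 1)))) hxy
    simp only [Int.cast_add, Int.cast_mul, Int.cast_pow, Int.cast_natCast, Int.cast_one, hp0, mul_zero,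
      add_zero] at h
    rw [mul_comm]
    exact h
  obtain ⟨u, hu⟩ := hunit
  refine ⟨n, u, ?_⟩
  -- `[u.val/p^{n+1}]⁺ = [a/p^{n+1}]⁺` by periodicity
  have hval : (((u : ZMod (p ^ (n + 1))).val : ℤ)) = a % (p ^ (n + 1) : ℕ) := by
    rw [hu, ZMod.val_intCast]
  have heq : (((u : ZMod (p ^ (n + 1))).val : ℚ) / (p : ℚ) ^ (n + 1)) =
      (a : ℚ) / (p : ℚ) ^ (n + 1) + ((-(a / (p ^ (n + 1) : ℕ)) : ℤ) : ℚ) := by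
    have hpq : ((p : ℚ) ^ (n + 1)) ≠ 0 := pow_ne_zero _ (by exact_mod_cast hp.ne_zero)
    have hdiv := Int.mul_ediv_add_emod a (p ^ (n + 1) : ℕ)
    have hvalq : (((u : ZMod (p ^ (n + 1))).val : ℚ)) = ((a % (p ^ (n + 1) : ℕ) : ℤ) : ℚ) := by
      exact_mod_cast hval
    rw [hvalq]
    field_simp
    have h2 : ((a % (p ^ (n + 1) : ℕ) : ℤ) : ℚ) = (a : ℚ) - ((p ^ (n + 1) : ℕ) : ℚ) * ((a / (p ^ (n + 1) : ℕ) : ℤ) : ℚ) := by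
      have h3 : (((p ^ (n + 1) : ℕ) : ℤ) * (a / (p ^ (n + 1) : ℕ)) + a % (p ^ (n + 1) : ℕ) : ℤ) = a := hdiv
      have h4 := congr_arg (fun z : ℤ ↦ (z : ℚ)) h3
      push_cast at h4 ⊢
      linarith
    rw [h2]
    push_cast
    ring
  rw [heq, ratPlusSymbol_add_intCast_eq]
  exact hnorm

/-- **The newform of an elliptic curve**: `W/ℚ` globally minimal with good reduction at the odd prime `p` and `a_p = 0`, `f` its
newform of level `N`; LEMMA′(N,p) ⇒ some `[u/p^{n+1}]⁺_f` (`u` a unit) is a `p`-adic unit.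
[cite: MazurTateTeitelbaum1986Invent, §I.4 (4.2) and §I.8] -/
theorem exists_unit_norm_ratPlusSymbol_eq_one_of_lemmaPrime_of_isNewformOf {W : WeierstrassCurve ℚ} [W.IsElliptic]
    [W.IsGloballyMinimal] (hp2 : p ≠ 2) (hf : IsNewformOf W f) (hgood : W.HasGoodReductionAtPrime p)
    (hap : W.frobeniusTrace p = 0)
    (hLemma : ∀ ψ : Gamma0 N →* Multiplicative (ZMod p),
      (∀ γ : Gamma0 N, (∃ k : ℕ, ((γ : SL(2, ℤ)) 1 1 : ℤ) = (p : ℤ) ^ k ∨ ((γ : SL(2, ℤ)) 1 1 : ℤ) = -((p : ℤ) ^ k)) →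
        ψ γ = 1) →
      ∃ χ : (ZMod N)ˣ →* Multiplicative (ZMod p),
        (∀ u : (ZMod N)ˣ, (u : ZMod N) = (p : ZMod N) → χ u = 1) ∧
        ∀ (γ : Gamma0 N) (u : (ZMod N)ˣ), (u : ZMod N) = (((γ : SL(2, ℤ)) 1 1 : ℤ) : ZMod N) → ψ γ = χ u) :
    ∃ (n : ℕ) (u : (ZMod (p ^ (n + 1)))ˣ),
      ‖((ratPlusSymbol f (((u : ZMod (p ^ (n + 1))).val : ℚ) / (p : ℚ) ^ (n + 1)) : ℚ) : ℚ_[p])‖ = 1 := by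
  have hpN : ¬ p ∣ N := not_dvd_level_of_isNewformOf hf hgood
  have hap' : cuspCoeff f p = ((0 : ℤ) : ℂ) := by
    rw [cuspCoeff_eq_frobeniusTrace_of_isNewformOf_holds hf hgood, hap]
  exact exists_unit_norm_ratPlusSymbol_eq_one_of_lemmaPrime f hp2 hf.1 hf.coeffField_eq_bot hpN hap' hLemma

/-- **THEOREM A of `EG-REDUCTION-g8` in the kernel, modulo LEMMA′(N,3)**: for `W/ℚ` globally minimal with good reduction at
`3` and `a₃ = 0` and its newform `f` of level `N`, LEMMA′(N,3) gives a signed Pollack function with UNIT CONTENT: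
`∃ ε L, IsSignedPAdicLFunction f 3 ε L ∧ HasUnitContent L`, i.e. `min(μ(L₃⁺), μ(L₃⁻)) = 0` (the landed
`SmallImageOrbitSumMuThree.exists_sign_hasUnitContent_three_of_norm_ratPlusSymbol_eq_one`, p636964). This is exactly
`stub_muOneSign_ns_three` of line `birth_acns` v6 modulo the group-theoretic LEMMA′(N_E, 3).
[cite: PollackWeston2011, Thm. 4.1 (1) and Remark 4.2] [cite: MazurTateTeitelbaum1986Invent, §I.4 (4.2) and §I.8] -/
theorem exists_sign_hasUnitContent_three_of_lemmaPrime (hp3 : p = 3) {W : WeierstrassCurve ℚ} [W.IsElliptic]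
    [W.IsGloballyMinimal] (hf : IsNewformOf W f) (hgood : W.HasGoodReductionAtPrime p) (hap : W.frobeniusTrace p = 0)
    (hLemma : ∀ ψ : Gamma0 N →* Multiplicative (ZMod p),
      (∀ γ : Gamma0 N, (∃ k : ℕ, ((γ : SL(2, ℤ)) 1 1 : ℤ) = (p : ℤ) ^ k ∨ ((γ : SL(2, ℤ)) 1 1 : ℤ) = -((p : ℤ) ^ k)) →
        ψ γ = 1) →
      ∃ χ : (ZMod N)ˣ →* Multiplicative (ZMod p),
        (∀ u : (ZMod N)ˣ, (u : ZMod N) = (p : ZMod N) → χ u = 1) ∧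
        ∀ (γ : Gamma0 N) (u : (ZMod N)ˣ), (u : ZMod N) = (((γ : SL(2, ℤ)) 1 1 : ℤ) : ZMod N) → ψ γ = χ u) :
    ∃ (ε : ℤˣ) (L : IwasawaAlgebra p), IsSignedPAdicLFunction f p ε L ∧ HasUnitContent L := by
  subst hp3
  obtain ⟨n, u, hunit⟩ := exists_unit_norm_ratPlusSymbol_eq_one_of_lemmaPrime_of_isNewformOf f (by decide) hf hgood
    hap hLemma
  exact Summit.BirchSwinnertonDyer.BirchSwinnertonDyer.Theorems.SmallImageOrbitSumMuThree.exists_sign_hasUnitContent_three_of_norm_ratPlusSymbol_eq_one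
    f hf hgood hap u hunit

end Summit.BirchSwinnertonDyer.BirchSwinnertonDyer.Theorems.SmallImageHeckePrimeMu

end
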